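import Literature.MathematicalPhysics.QuantumLattice.SuperlatticeCellEnergyFamilies
import Literature.MathematicalPhysics.QuantumLattice.LatticeVectorHoppingInteraction
import HarnessLib

/-!
# Sublattice-selective atoms of superlattice one-band models: hopping along `v` restricted to bonds starting
# in one coset, on-site energy / repulsion on one coset, their VIEWS from the fundamental cell, and the
# staggered-potential (ionic) Hubbard model as a worked instance

Topic `Literature/MathematicalPhysics/QuantumLattice` (family `hubbard`; general dimension `d`). Sequel of
`LatticeVectorHoppingInteraction` (`vectorHoppingFermionInteraction d v t`, the bond term and its norm),
`PeriodicStatesCellAverage` (`IsPeriodic`, `Cell`, `cellPos`) and `SuperlatticeCellEnergyFamilies` (the cell energy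
`e_M(ω) = |C|⁻¹ Σ_n e_{M n}(ω ∘ τ_{pos n})` of a family of views, `viewFamily`, `infCellEnergyOn` and its
calculus). Written for stage S2 (CERTIFIER-FAMILIES, «families of models», D-0096 (ii): multi-band, ladders,
staggered fields) of the Hubbard material-oracle programme: the previous file is the model-free calculus of
superlattice models given by their views; this file supplies the ATOMS of such models inside the one-band CAR
framework over `ℤ^d` — interactions that act only on one coset of a rectangular superlattice — together with
their views (the same atom with the coset label re-centred), so that decorated lattices (Lieb-lattice `CuO₂`
planes by decoration of `ℤ²`), trellis/ladder arrays (router boxes #32/#38), Peierls-dimerised or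
staggered-potential models become `viewFamily` instances of that calculus.

* §1 cosets `InCoset q c x` (coordinatewise congruence modulo the periods `q_i + 1`; reducible, decidable):
  re-centring `x ∈ coset(c − w) ↔ x + w ∈ coset(c)`, invariance under the periods.
* §2 **`sublatticeVectorHopping q c v t`**: the bond term `−tΣ_σ(c†_{xσ}c_{x+v,σ} + h.c.)` on the bonds `{x, x+v}`
  with `x ∈ coset(c)`, zero elsewhere; even, Hermitian, linear in `t`; on its coset it IS the full bond term
  (`…_apply_pair_of_inCoset`), off it `0`, case-free form `[x ∈ coset(c)] • Φ_v{x,x+v}`.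
* §3 its mean-energy observable (two half bonds through the origin, each present or not), `‖E‖ ≤ 2|t|`,
  `|e(ω)| ≤ 2|t|` for every state.
* §4 its VIEWS `sublatticeVectorHoppingViews q c v t n = sublatticeVectorHopping q (c − pos n) v t` and the class
  constant `|cellEnergy (views) ω| ≤ 2|t|` (every state) for the Lipschitz bound of the calculus.
* §5 **`sublatticeOnSite q c ε U`**: `Φ{x} = ε(n_{x↑}+n_{x↓}) + U n_{x↑}n_{x↓}` on `coset(c)`; even, Hermitian,
  `E = Γ(Φ{0})`, `e(ω) = [0 ∈ coset(c)]·(ε ρ(ω) + U D(ω))`, `‖E‖, |e(ω)| ≤ 2|ε| + |U|`; views and their class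
  constant.
* §6 WORKED INSTANCE: the ionic (staggered-potential) Hubbard model along an axis `i₀` —
  `ionicHubbardViews i₀ t U (ε_A, ε_B)` = constant views `Φ^{t,U}` + the on-site views of the two layers — with,
  by instantiation, joint concavity of the variational cell energy in `(ε_A, ε_B)` over any class, the Lipschitz
  bound `Σ_a 2|Δε_a|`, and at zero staggering the translation-invariant Hubbard density
  (`infCellEnergyOn_ionicHubbard_zero`, through `infCellEnergyOn_periodic_const_eq_tiGroundEnergyDensity`).

Everything is PROVED; definitions with bodies (`InCoset` (abbrev), `sublatticeVectorHopping`, `…Views`,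
`sublatticeOnSite`, `…Views`, `layerPeriods`, `ionicHubbardViews`), no named fact, no number of record, no
`sorry`. HONEST SCOPE: energy words only; norm (not kinematic) class constants for the sublattice atoms (a
sublattice-selective hopping is not translation covariant, so the `16/π²` pair rows do not transfer as such);
the decorated `CuO₂` (three-band) and trellis instances need, in addition, the conserved sublattice charges of
`TIGroundEnergyDensityConservedDensities` to pin the filling of the physical orbitals — left to a sequel;
nothing here certifies a number about a material.

## Mathlib / tree search

REUSED: `vectorHoppingFermionInteraction(_apply_pair)`, `norm_fermionEmbed_vectorHopping_pair_le_two_mul`,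
`self_ne_add_of_ne_zero`, `add_add_ne_self_of_ne_zero`, `card_pair_add_of_ne_zero`, `pair_zero_ne_pair_neg`,
`pair(_neg)_subset_thicken_zero` (`LatticeVectorHoppingInteraction`); `periodVec`, `Cell`, `cellPos`
(`PeriodicStatesCellAverage`); `InfVolFermionState.cellEnergy`, `viewFamily`, `infCellEnergyOn`, `periodicStates`,
`concaveOn_infCellEnergyOn_viewFamily`, `abs_infCellEnergyOn_viewFamily_sub_le`, `infCellEnergyOn_periodic_const_eq_tiGroundEnergyDensity`
(`SuperlatticeCellEnergyFamilies`); `FermionInteraction.meanEnergyObs_eq_sum`, `fermionEmbed_numberOp`, `numberAt_isHermitian/commute`,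
`norm_numberOp_le_one`, `density_nonneg/le_two`, `abs_meanEnergy_le_norm`, `FermionInteraction.linearFamily_zero`.
`lean search 'sublattice.*Hopping|InCoset|ionicHubbard|staggered' --decl` (QuantumLattice): nothing of this kind.

## References

* H. Araki, H. Moriya, Rev. Math. Phys. 15 (2003) 93, §4.1 (local algebras, translations), §5.1 (potentials).
  [cite: ArakiMoriya2003, §4.1]
* E. Pavarini et al., PRL 87 (2001) 047003, eq. (1) (one-band hopping terms). [cite: PavariniEtAl2001, eq. (1)]
* E. H. Lieb, arXiv:cond-mat/9311033, §2 (the Hubbard Hamiltonian on a general graph / bipartite decorations).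
  [cite: arXiv9311033, §2 (the Hubbard Hamiltonian)]
* O. Bratteli, A. Kishimoto, D. W. Robinson, CMP 64 (1978) 41, §3. [cite: BratteliKishimotoRobinson1978, §3 (mean energy functional)]
* O. Bratteli, D. W. Robinson, *OAQSM 1* (1987), Prop. 2.3.11. [cite: BratteliRobinsonI1987, Prop. 2.3.11]
* R. B. Israel, *Convexity in the Theory of Lattice Gases* (1979), Thm. I.3.4. [cite: Israel1979, Thm. I.3.4]
-/

noncomputable section

namespace Literature.MathematicalPhysics.QuantumLattice

open Matrix Finset HubbardWave0 Literature.Probability.LatticeModels ThermodynamicLimit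
open Literature.Computation.Certificates
open scoped ComplexOrder BigOperators

/-! ### §1. Cosets of the rectangular superlattice -/

section Coset

variable {d : ℕ}

/-- **`x` lies in the coset `c + ⊕_i (q_i+1)ℤe_i`** of the rectangular superlattice with periods `q_i + 1`
(coordinatewise congruence). A reducible definition, so that it can be decided inside interaction terms.
[cite: ArakiMoriya2003, §4.1] -/
abbrev InCoset (q : Fin d → ℕ) (c x : Site d) : Prop := ∀ i : Fin d, (x i - c i) % ((q i : ℤ) + 1) = 0

/-- Every point lies in its own coset. [cite: ArakiMoriya2003, §4.1] -/
theorem inCoset_self (q : Fin d → ℕ) (c : Site d) : InCoset q c c := fun i => by simp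

/-- **Re-centring**: `x ∈ coset(c − w) ↔ x + w ∈ coset(c)` — translating the pattern by `−w` is translating the
point by `+w`. [cite: ArakiMoriya2003, §4.1] -/
theorem inCoset_sub_iff (q : Fin d → ℕ) (c w x : Site d) : InCoset q (c - w) x ↔ InCoset q c (x + w) := by
  refine forall_congr' fun i => ?_
  rw [Pi.sub_apply, Pi.add_apply, show x i - (c i - w i) = x i + w i - c i by ring]

/-- The origin lies in `coset(c − w)` iff `w ∈ coset(c)`. [cite: ArakiMoriya2003, §4.1] -/
theorem inCoset_sub_zero_iff (q : Fin d → ℕ) (c w : Site d) : InCoset q (c - w) 0 ↔ InCoset q c w := by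
  rw [inCoset_sub_iff, zero_add]

/-- Cosets are invariant under the periods: `x + P_i ∈ coset(c) ↔ x ∈ coset(c)`. [cite: ArakiMoriya2003, §4.1] -/
theorem inCoset_add_periodVec_iff (q : Fin d → ℕ) (c x : Site d) (i : Fin d) :
    InCoset q c (x + periodVec q i) ↔ InCoset q c x := by
  refine forall_congr' fun j => ?_
  rw [Pi.add_apply, periodVec]
  by_cases hj : j = i
  · subst hj
    rw [Pi.single_eq_same, show x j + ((q j : ℤ) + 1) - c j = x j - c j + ((q j : ℤ) + 1) by ring,
      Int.add_emod_right]
  · rw [Pi.single_eq_of_ne hj, add_zero]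

end Coset

/-! ### §2. The hopping interaction along `v` restricted to bonds starting in one coset -/

section SubHop

variable {d : ℕ}

/-- **Sublattice-selective hopping**: the hopping interaction along the lattice vector `v` with amplitude `t`
on the bonds `{x, x + v}` whose START `x` lies in the coset `c` of the rectangular superlattice `q`:
`Φ {x, x+v} = −t Σ_σ (c†_{xσ}c_{x+v,σ} + h.c.)` if `x ∈ coset(c)`, `0` otherwise (and `0` on every other set).
The atom of every decorated-lattice / ladder / superlattice one-band model (Lieb-lattice `CuO₂` planes by
decoration of `ℤ²`, trellis ladders, Peierls-dimerised chains). [cite: PavariniEtAl2001, eq. (1)] -/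
def sublatticeVectorHopping (q : Fin d → ℕ) (c v : Site d) (t : ℝ) : FermionInteraction d where
  Φ X :=
    ∑ x ∈ X.attach, ∑ y ∈ X.attach,
      if (y.1 = x.1 + v ∧ X = {x.1, y.1}) ∧ InCoset q c x.1 then
        -(t : ℂ) • ∑ σ : Fin 2, ((cAt x.1 x.2 σ)ᴴ * cAt y.1 y.2 σ + (cAt y.1 y.2 σ)ᴴ * cAt x.1 x.2 σ)
      else 0

/-- Sublattice-selective hopping is even. [cite: ArakiMoriya2003, §1 assumption (II)] -/
theorem sublatticeVectorHopping_isEven (q : Fin d → ℕ) (c v : Site d) (t : ℝ) :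
    (sublatticeVectorHopping q c v t).IsEven := by
  intro X
  have hc : ∀ (x y : Site d) (hx : x ∈ X) (hy : y ∈ X) (σ : Fin 2),
      parityAut ((cAt x hx σ)ᴴ * cAt y hy σ) = (cAt x hx σ)ᴴ * cAt y hy σ := by
    intro x y hx hy σ
    rw [cAt, cAt, annihilation_conjTranspose, map_mul, parityAut_creation, parityAut_annihilation,
      neg_mul_neg]
  simp only [sublatticeVectorHopping, map_sum, apply_ite parityAut, map_zero, map_smul, map_add, hc]

/-- Sublattice-selective hopping is Hermitian. [cite: ArakiMoriya2003, §1 assumption (II)] -/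
theorem sublatticeVectorHopping_isHermitian (q : Fin d → ℕ) (c v : Site d) (t : ℝ) :
    (sublatticeVectorHopping q c v t).IsHermitian := by
  intro X
  have hc : ∀ (x y : Site d) (hx : x ∈ X) (hy : y ∈ X) (σ : Fin 2),
      ((cAt x hx σ)ᴴ * cAt y hy σ + (cAt y hy σ)ᴴ * cAt x hx σ)ᴴ =
        (cAt x hx σ)ᴴ * cAt y hy σ + (cAt y hy σ)ᴴ * cAt x hx σ := by
    intro x y hx hy σ
    rw [Matrix.conjTranspose_add, Matrix.conjTranspose_mul, Matrix.conjTranspose_mul,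
      Matrix.conjTranspose_conjTranspose, Matrix.conjTranspose_conjTranspose, add_comm]
  unfold Matrix.IsHermitian sublatticeVectorHopping
  simp only [Matrix.conjTranspose_sum, apply_ite Matrix.conjTranspose, Matrix.conjTranspose_zero,
    Matrix.conjTranspose_smul, hc, Complex.star_def, map_neg, Complex.conj_ofReal]

/-- Scaling in the amplitude: `Φ^{a·t} X = a • Φ^{t} X`. [cite: PavariniEtAl2001, eq. (1)] -/
theorem sublatticeVectorHopping_smul_apply (q : Fin d → ℕ) (c v : Site d) (a t : ℝ) (X : Finset (Site d)) :
    (sublatticeVectorHopping q c v (a * t)).Φ X = (a : ℂ) • (sublatticeVectorHopping q c v t).Φ X := by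
  simp only [sublatticeVectorHopping, Finset.smul_sum, smul_ite, smul_zero, smul_smul, Complex.ofReal_mul, mul_neg]

/-- **On its coset the sublattice-selective hopping is the full hopping term**: for `x ∈ coset(c)`,
`Φ_{c,v} {x, x+v} = Φ_v {x, x+v}`. [cite: PavariniEtAl2001, eq. (1)] -/
theorem sublatticeVectorHopping_apply_pair_of_inCoset (q : Fin d → ℕ) (c : Site d) {v : Site d} (hv : v ≠ 0)
    (t : ℝ) {x : Site d} (hx : InCoset q c x) :
    (sublatticeVectorHopping q c v t).Φ {x, x + v} = (vectorHoppingFermionInteraction d v t).Φ {x, x + v} := by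
  have hmem : ∀ {a : Site d}, a ∈ ({x, x + v} : Finset (Site d)) ↔ a = x ∨ a = x + v :=
    fun {a} => by rw [mem_insert, mem_singleton]
  rw [vectorHoppingFermionInteraction_apply_pair hv]
  simp only [sublatticeVectorHopping]
  rw [Finset.sum_eq_single ⟨x, mem_insert_self _ _⟩]
  · rw [Finset.sum_eq_single ⟨x + v, mem_insert_of_mem (mem_singleton_self _)⟩, if_pos ⟨⟨rfl, rfl⟩, hx⟩]
    · rintro ⟨b, hb⟩ - hne
      refine if_neg ?_
      rintro ⟨⟨hb', -⟩, -⟩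
      exact hne (Subtype.ext hb')
    · intro h
      exact absurd (mem_attach _ _) h
  · rintro ⟨a, ha⟩ - hne
    refine Finset.sum_eq_zero fun b _ => if_neg ?_
    rintro ⟨⟨hb, -⟩, -⟩
    rcases hmem.1 ha with rfl | rfl
    · exact hne rfl
    · rcases hmem.1 b.2 with hb' | hb'
      · exact add_add_ne_self_of_ne_zero x hv (hb.symm.trans hb')
      · exact self_ne_add_of_ne_zero (x + v) hv (hb'.symm.trans hb)
  · intro h
    exact absurd (mem_attach _ _) h

/-- **Off its coset the sublattice-selective hopping vanishes**: for `x ∉ coset(c)`, `Φ_{c,v} {x, x+v} = 0`.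
[cite: PavariniEtAl2001, eq. (1)] -/
theorem sublatticeVectorHopping_apply_pair_of_not_inCoset (q : Fin d → ℕ) (c : Site d) {v : Site d} (hv : v ≠ 0)
    (t : ℝ) {x : Site d} (hx : ¬ InCoset q c x) : (sublatticeVectorHopping q c v t).Φ {x, x + v} = 0 := by
  have hmem : ∀ {a : Site d}, a ∈ ({x, x + v} : Finset (Site d)) ↔ a = x ∨ a = x + v :=
    fun {a} => by rw [mem_insert, mem_singleton]
  simp only [sublatticeVectorHopping]
  refine Finset.sum_eq_zero fun a _ => Finset.sum_eq_zero fun b _ => if_neg ?_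
  rintro ⟨⟨hb, -⟩, ha⟩
  obtain ⟨a, ha'⟩ := a
  obtain ⟨b, hb''⟩ := b
  simp only at hb ha
  rcases hmem.1 ha' with rfl | rfl
  · exact hx ha
  · rcases hmem.1 hb'' with hb' | hb'
    · exact add_add_ne_self_of_ne_zero x hv (hb.symm.trans hb')
    · exact self_ne_add_of_ne_zero (x + v) hv (hb'.symm.trans hb)

/-- On sets that are not `v`-bonds the sublattice-selective hopping vanishes. [cite: PavariniEtAl2001, eq. (1)] -/
theorem sublatticeVectorHopping_apply_eq_zero (q : Fin d → ℕ) (c v : Site d) (t : ℝ) {X : Finset (Site d)}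
    (h2 : ∀ x : Site d, X ≠ {x, x + v}) : (sublatticeVectorHopping q c v t).Φ X = 0 := by
  have hB : ∀ a b : Site d, ¬ ((b = a + v ∧ X = {a, b}) ∧ InCoset q c a) := by
    rintro a b ⟨⟨rfl, h⟩, -⟩
    exact h2 a h
  simp only [sublatticeVectorHopping, hB, if_false, sum_const_zero]

/-- **Case-free form**: `Φ_{c,v} {x, x+v} = [x ∈ coset(c)] • Φ_v {x, x+v}`. [cite: PavariniEtAl2001, eq. (1)] -/
theorem sublatticeVectorHopping_apply_pair (q : Fin d → ℕ) (c : Site d) {v : Site d} (hv : v ≠ 0) (t : ℝ) (x : Site d) :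
    (sublatticeVectorHopping q c v t).Φ {x, x + v} =
      if InCoset q c x then (vectorHoppingFermionInteraction d v t).Φ {x, x + v} else 0 := by
  by_cases hx : InCoset q c x
  · rw [if_pos hx, sublatticeVectorHopping_apply_pair_of_inCoset q c hv t hx]
  · rw [if_neg hx, sublatticeVectorHopping_apply_pair_of_not_inCoset q c hv t hx]

end SubHop

/-! ### §3. The mean-energy observable and its norm -/

section SubHopMeanEnergy

variable {d : ℕ} (q : Fin d → ℕ) (c : Site d) {v : Site d} (hv : v ≠ 0) (t : ℝ)
include hv

/-- **The mean-energy observable of the sublattice-selective hopping**: `E = ½Γ(Φ_{c,v}{0,v}) + ½Γ(Φ_{c,v}{−v,0})`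
(each term the full bond or zero according to the coset of its start). [cite: BratteliKishimotoRobinson1978, §3 (mean energy functional)] -/
theorem sublatticeVectorHopping_meanEnergyObs {R : ℝ} (hvR : v ∈ thicken ({0} : Finset (Site d)) R) :
    (sublatticeVectorHopping q c v t).meanEnergyObs R =
      (2 : ℂ)⁻¹ • fermionEmbed (PolySite.incl (pair_subset_thicken_zero hvR))
          ((sublatticeVectorHopping q c v t).Φ {0, 0 + v}) +
        (2 : ℂ)⁻¹ • fermionEmbed (PolySite.incl (pair_neg_subset_thicken_zero hvR))
          ((sublatticeVectorHopping q c v t).Φ {-v, -v + v}) := by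
  classical
  set T : Finset (Site d) := thicken ({0} : Finset (Site d)) R with hT
  set F : Finset (Site d) → FermionOp T := fun X =>
    if h : X ⊆ T then ((X.card : ℂ)⁻¹) • fermionEmbed (PolySite.incl h) ((sublatticeVectorHopping q c v t).Φ X)
    else 0 with hF
  rw [FermionInteraction.meanEnergyObs_eq_sum]
  change ∑ X ∈ T.powerset with (0 : Site d) ∈ X, F X = _
  set S' : Finset (Finset (Site d)) := {({0, 0 + v} : Finset (Site d)), {-v, -v + v}} with hS'
  have hS'sub : S' ⊆ T.powerset.filter fun X => (0 : Site d) ∈ X := by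
    intro X hX
    rw [hS', mem_insert, mem_singleton] at hX
    rw [mem_filter, mem_powerset]
    rcases hX with rfl | rfl
    · exact ⟨pair_subset_thicken_zero hvR, mem_insert_self _ _⟩
    · refine ⟨pair_neg_subset_thicken_zero hvR, ?_⟩
      rw [neg_add_cancel]
      exact mem_insert_of_mem (mem_singleton_self _)
  have hzero : ∀ X ∈ T.powerset.filter (fun X => (0 : Site d) ∈ X), X ∉ S' → F X = 0 := by
    intro X hX hXS
    rw [mem_filter, mem_powerset] at hX
    have hΦ : (sublatticeVectorHopping q c v t).Φ X = 0 := by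
      refine sublatticeVectorHopping_apply_eq_zero q c v t (fun x hx => hXS ?_)
      have h0 := hX.2
      rw [hx, mem_insert, mem_singleton] at h0
      rw [hS', hx, mem_insert, mem_singleton]
      rcases h0 with h0 | h0
      · exact Or.inl (by rw [← h0, zero_add])
      · refine Or.inr ?_
        have : x = -v := eq_neg_of_add_eq_zero_left h0.symm
        rw [this]
    simp only [hF, hΦ, map_zero, smul_zero, dite_eq_ite, ite_self]
  rw [← Finset.sum_subset hS'sub hzero, hS', Finset.sum_pair (pair_zero_ne_pair_neg hv)]
  have h1T : ({0, 0 + v} : Finset (Site d)) ⊆ T := pair_subset_thicken_zero hvR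
  have h2T : ({-v, -v + v} : Finset (Site d)) ⊆ T := pair_neg_subset_thicken_zero hvR
  have hF1 : F {0, 0 + v} =
      (2 : ℂ)⁻¹ • fermionEmbed (PolySite.incl h1T) ((sublatticeVectorHopping q c v t).Φ {0, 0 + v}) := by
    simp only [hF]
    rw [dif_pos h1T, card_pair_add_of_ne_zero (0 : Site d) hv, Nat.cast_ofNat]
  have hF2 : F {-v, -v + v} =
      (2 : ℂ)⁻¹ • fermionEmbed (PolySite.incl h2T) ((sublatticeVectorHopping q c v t).Φ {-v, -v + v}) := by
    simp only [hF]
    rw [dif_pos h2T, card_pair_add_of_ne_zero (-v : Site d) hv, Nat.cast_ofNat]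
  rw [hF1, hF2]

open scoped Matrix.Norms.L2Operator in
/-- An embedded sublattice-selective bond term has norm `≤ 2|t|` (it is the full bond term or zero).
[cite: KomaTasakiPRL1992, eq. (11) remark] -/
theorem norm_fermionEmbed_sublatticeVectorHopping_pair_le {Λ' : Finset (Site d)} (x : Site d)
    (h : ({x, x + v} : Finset (Site d)) ⊆ Λ') :
    ‖fermionEmbed (PolySite.incl h) ((sublatticeVectorHopping q c v t).Φ {x, x + v})‖ ≤ 2 * |t| := by
  rw [sublatticeVectorHopping_apply_pair q c hv]
  by_cases hx : InCoset q c x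
  · rw [if_pos hx]
    exact norm_fermionEmbed_vectorHopping_pair_le_two_mul hv t x h
  · rw [if_neg hx, map_zero, norm_zero]
    positivity

open scoped Matrix.Norms.L2Operator in
/-- **`‖E_{Φ_{c,v}}‖ ≤ 2|t|`.** [cite: BratteliRobinsonI1987, Prop. 2.3.11] -/
theorem norm_meanEnergyObs_sublatticeVectorHopping_le {R : ℝ} (hvR : v ∈ thicken ({0} : Finset (Site d)) R) :
    ‖(sublatticeVectorHopping q c v t).meanEnergyObs R‖ ≤ 2 * |t| := by
  rw [sublatticeVectorHopping_meanEnergyObs q c hv t hvR]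
  have hhalf : ‖(2 : ℂ)⁻¹‖ = 2⁻¹ := by simp
  refine (norm_add_le _ _).trans ?_
  rw [norm_smul, norm_smul, hhalf]
  have h1 := norm_fermionEmbed_sublatticeVectorHopping_pair_le q c hv t (0 : Site d) (pair_subset_thicken_zero hvR)
  have h2 := norm_fermionEmbed_sublatticeVectorHopping_pair_le q c hv t (-v : Site d) (pair_neg_subset_thicken_zero hvR)
  linarith

/-- **`|e_{Φ_{c,v}}(ω)| ≤ 2|t|` for every state.** [cite: BratteliRobinsonI1987, Prop. 2.3.11] -/
theorem abs_meanEnergy_sublatticeVectorHopping_le (ω : InfVolFermionState d) {R : ℝ}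
    (hvR : v ∈ thicken ({0} : Finset (Site d)) R) :
    |ω.meanEnergy (sublatticeVectorHopping q c v t) R| ≤ 2 * |t| :=
  (ω.abs_meanEnergy_le_norm _ R).trans (norm_meanEnergyObs_sublatticeVectorHopping_le q c hv t hvR)

end SubHopMeanEnergy

/-! ### §4. The views of a sublattice-selective hopping and their bookkeeping -/

section Views

variable {d : ℕ}

/-- **The views of the periodic hopping pattern** «bonds `{x, x+v}`, `x ∈ coset(c)`» from the points of the
fundamental cell: seen with the cell point `n` at the origin the pattern is the same pattern with coset label
`c − pos(n)` (`0 ∈ coset(c − pos n) ↔ pos n ∈ coset(c)`, `inCoset_sub_zero_iff`). [cite: ArakiMoriya2003, §4.1] -/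
def sublatticeVectorHoppingViews (q : Fin d → ℕ) (c v : Site d) (t : ℝ) : Cell q → FermionInteraction d :=
  fun n => sublatticeVectorHopping q (c - cellPos n) v t

/-- The views scale linearly in the amplitude (view by view). [cite: PavariniEtAl2001, eq. (1)] -/
theorem sublatticeVectorHoppingViews_smul_apply (q : Fin d → ℕ) (c v : Site d) (a t : ℝ) (n : Cell q)
    (X : Finset (Site d)) :
    (sublatticeVectorHoppingViews q c v (a * t) n).Φ X = (a : ℂ) • (sublatticeVectorHoppingViews q c v t n).Φ X :=
  sublatticeVectorHopping_smul_apply q _ v a t X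

/-- **Every view's cell-averaged energy is bounded by `2|t|`** (so `2` per unit amplitude is a class constant for
the Lipschitz bound of `SuperlatticeCellEnergyFamilies`). [cite: BratteliRobinsonI1987, Prop. 2.3.11] -/
theorem abs_cellEnergy_sublatticeVectorHoppingViews_le (q : Fin d → ℕ) (c : Site d) {v : Site d} (hv : v ≠ 0)
    (t : ℝ) {R : ℝ} (hvR : v ∈ thicken ({0} : Finset (Site d)) R) (ω : InfVolFermionState d) :
    |ω.cellEnergy (sublatticeVectorHoppingViews q c v t) R| ≤ 2 * |t| := by
  have hcard : (0 : ℝ) < (Fintype.card (Cell q) : ℝ) := Nat.cast_pos.2 Fintype.card_pos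
  rw [InfVolFermionState.cellEnergy, abs_mul, abs_of_pos (inv_pos.2 hcard)]
  calc (Fintype.card (Cell q) : ℝ)⁻¹ * |∑ n : Cell q, (ω.shift (cellPos n)).meanEnergy (sublatticeVectorHoppingViews q c v t n) R|
      ≤ (Fintype.card (Cell q) : ℝ)⁻¹ * ∑ _n : Cell q, 2 * |t| := by
        refine mul_le_mul_of_nonneg_left ((Finset.abs_sum_le_sum_abs _ _).trans
          (Finset.sum_le_sum fun n _ => ?_)) (inv_pos.2 hcard).le
        exact abs_meanEnergy_sublatticeVectorHopping_le q _ hv t _ hvR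
    _ = 2 * |t| := by
        rw [Finset.sum_const, Finset.card_univ, nsmul_eq_mul, ← mul_assoc, inv_mul_cancel₀ hcard.ne', one_mul]

end Views

/-! ### §5. Sublattice-selective on-site terms (site energy `ε` and repulsion `U` on one coset) -/

section SubOnSite

variable {d : ℕ}

/-- **Sublattice-selective on-site interaction**: `Φ {x} = ε (n_{x↑} + n_{x↓}) + U n_{x↑}n_{x↓}` for `x` in the
coset `c` of the superlattice `q`, `0` on every other site and every other set — the decoration of one
sublattice by an orbital energy and its own Hubbard repulsion (Cu vs O sites of a decorated `CuO₂` plane, the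
staggered potential of the ionic Hubbard model, a pinning field on one sublattice).
[cite: arXiv9311033, §2 (the Hubbard Hamiltonian)] -/
def sublatticeOnSite (q : Fin d → ℕ) (c : Site d) (ε U : ℝ) : FermionInteraction d where
  Φ X :=
    ∑ x ∈ X.attach,
      if X = {x.1} ∧ InCoset q c x.1 then
        (ε : ℂ) • (nAt x.1 x.2 0 + nAt x.1 x.2 1) + (U : ℂ) • (nAt x.1 x.2 0 * nAt x.1 x.2 1)
      else 0

/-- The sublattice on-site interaction is even. [cite: ArakiMoriya2003, §1 assumption (II)] -/
theorem sublatticeOnSite_isEven (q : Fin d → ℕ) (c : Site d) (ε U : ℝ) : (sublatticeOnSite q c ε U).IsEven := by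
  intro X
  have hn : ∀ (x : Site d) (hx : x ∈ X) (σ : Fin 2), parityAut (nAt x hx σ) = nAt x hx σ := by
    intro x hx σ
    rw [nAt, numberOp, map_mul, parityAut_creation, parityAut_annihilation, neg_mul_neg]
  simp only [sublatticeOnSite, map_sum, apply_ite parityAut, map_zero, map_add, map_smul, map_mul, hn]

/-- The sublattice on-site interaction is Hermitian (real `ε`, `U`). [cite: ArakiMoriya2003, §1 assumption (II)] -/
theorem sublatticeOnSite_isHermitian (q : Fin d → ℕ) (c : Site d) (ε U : ℝ) : (sublatticeOnSite q c ε U).IsHermitian := by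
  intro X
  have h1 : ∀ (x : Site d) (hx : x ∈ X) (σ : Fin 2), (nAt x hx σ)ᴴ = nAt x hx σ := by
    intro x hx σ
    rw [nAt, ← numberAt_orb, (numberAt_isHermitian _).eq]
  have hn : ∀ (x : Site d) (hx : x ∈ X), (nAt x hx 0 * nAt x hx 1)ᴴ = nAt x hx 0 * nAt x hx 1 := by
    intro x hx
    rw [Matrix.conjTranspose_mul, nAt, nAt, ← numberAt_orb, ← numberAt_orb, (numberAt_isHermitian _).eq,
      (numberAt_isHermitian _).eq, (numberAt_commute _ _).eq]
  unfold Matrix.IsHermitian sublatticeOnSite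
  simp only [Matrix.conjTranspose_sum, apply_ite Matrix.conjTranspose, Matrix.conjTranspose_zero,
    Matrix.conjTranspose_add, Matrix.conjTranspose_smul, h1, hn, Complex.star_def, Complex.conj_ofReal]

/-- **On-site term on the coset**: `Φ {x} = ε (n_{x↑}+n_{x↓}) + U n_{x↑}n_{x↓}` for `x ∈ coset(c)`, `0` otherwise.
[cite: arXiv9311033, §2 (the Hubbard Hamiltonian)] -/
theorem sublatticeOnSite_apply_singleton (q : Fin d → ℕ) (c : Site d) (ε U : ℝ) (x : Site d) :
    (sublatticeOnSite q c ε U).Φ {x} =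
      if InCoset q c x then
        (ε : ℂ) • (nAt x (mem_singleton_self x) 0 + nAt x (mem_singleton_self x) 1) +
          (U : ℂ) • (nAt x (mem_singleton_self x) 0 * nAt x (mem_singleton_self x) 1)
      else 0 := by
  simp only [sublatticeOnSite]
  rw [Finset.sum_eq_single ⟨x, mem_singleton_self x⟩]
  · by_cases hc : InCoset q c x
    · rw [if_pos ⟨rfl, hc⟩, if_pos hc]
    · rw [if_neg (fun h => hc h.2), if_neg hc]
  · rintro ⟨b, hb⟩ - hne
    exact absurd (Subtype.ext (mem_singleton.1 hb)) hne
  · intro h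
    exact absurd (mem_attach _ _) h

/-- On sets that are not singletons the on-site interaction vanishes. [cite: arXiv9311033, §2] -/
theorem sublatticeOnSite_apply_eq_zero (q : Fin d → ℕ) (c : Site d) (ε U : ℝ) {X : Finset (Site d)}
    (h1 : ∀ x : Site d, X ≠ {x}) : (sublatticeOnSite q c ε U).Φ X = 0 := by
  simp only [sublatticeOnSite]
  exact Finset.sum_eq_zero fun x _ => if_neg fun h => h1 x.1 h.1

/-- **The mean-energy observable of the on-site term is its term at the origin**: `E = Γ(Φ{0})` (any range
parameter). [cite: BratteliKishimotoRobinson1978, §3 (mean energy functional)] -/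
theorem sublatticeOnSite_meanEnergyObs (q : Fin d → ℕ) (c : Site d) (ε U : ℝ) (R : ℝ) :
    (sublatticeOnSite q c ε U).meanEnergyObs R =
      fermionEmbed (PolySite.incl (singleton_subset_iff.2 (zero_mem_thicken_zero R))) ((sublatticeOnSite q c ε U).Φ {0}) := by
  classical
  set T : Finset (Site d) := thicken ({0} : Finset (Site d)) R with hT
  rw [FermionInteraction.meanEnergyObs_eq_sum]
  have h0T : ({0} : Finset (Site d)) ⊆ T := singleton_subset_iff.2 (zero_mem_thicken_zero R)
  have hmem : ({0} : Finset (Site d)) ∈ T.powerset.filter fun X => (0 : Site d) ∈ X :=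
    mem_filter.2 ⟨mem_powerset.2 h0T, mem_singleton_self _⟩
  rw [← Finset.sum_erase_add _ _ hmem, dif_pos h0T, card_singleton, Nat.cast_one, inv_one, one_smul]
  rw [Finset.sum_eq_zero, zero_add]
  intro X hX
  rw [mem_erase, mem_filter, mem_powerset] at hX
  have hΦ : (sublatticeOnSite q c ε U).Φ X = 0 := by
    refine sublatticeOnSite_apply_eq_zero q c ε U fun x hx => ?_
    have h0 := hX.2.2
    rw [hx, mem_singleton] at h0
    exact hX.1 (by rw [hx, h0])
  simp only [hΦ, map_zero, smul_zero, dite_eq_ite, ite_self]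

/-- **`e_{Φ}(ω) = [0 ∈ coset(c)] · (ε ρ(ω) + U D(ω))`** (`ρ` the density, `D(ω) = Re ω(n_{0↑}n_{0↓})` the double
occupancy at the origin), every state, every range parameter. [cite: BratteliKishimotoRobinson1978, §3 (mean energy functional)] -/
theorem InfVolFermionState.meanEnergy_sublatticeOnSite (ω : InfVolFermionState d) (q : Fin d → ℕ) (c : Site d)
    (ε U R : ℝ) :
    ω.meanEnergy (sublatticeOnSite q c ε U) R =
      if InCoset q c 0 then
        ε * ω.density + U * (ω.expect {0} (nAt (0 : Site d) (mem_singleton_self 0) 0 * nAt 0 (mem_singleton_self 0) 1)).re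
      else 0 := by
  rw [InfVolFermionState.meanEnergy, sublatticeOnSite_meanEnergyObs, ω.compatible, sublatticeOnSite_apply_singleton]
  by_cases hc : InCoset q c 0
  · rw [if_pos hc, if_pos hc, map_add, map_smul, map_smul, Complex.add_re, smul_eq_mul, smul_eq_mul,
      Complex.re_ofReal_mul, Complex.re_ofReal_mul, InfVolFermionState.density, InfVolFermionState.densityAt]
  · rw [if_neg hc, if_neg hc, map_zero, Complex.zero_re]

open scoped Matrix.Norms.L2Operator in
/-- **`‖E_Φ‖ ≤ 2|ε| + |U|`** (`‖n_{xσ}‖ ≤ 1`). [cite: BratteliRobinsonI1987, Prop. 2.3.11] -/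
theorem norm_meanEnergyObs_sublatticeOnSite_le (q : Fin d → ℕ) (c : Site d) (ε U R : ℝ) :
    ‖(sublatticeOnSite q c ε U).meanEnergyObs R‖ ≤ 2 * |ε| + |U| := by
  rw [sublatticeOnSite_meanEnergyObs, sublatticeOnSite_apply_singleton]
  by_cases hc : InCoset q c 0
  · rw [if_pos hc, map_add, map_smul, map_smul, map_add, map_mul]
    simp only [nAt, fermionEmbed_numberOp]
    have hn : ∀ σ : Fin 2, ‖(numberOp ((PolySite.incl (singleton_subset_iff.2 (zero_mem_thicken_zero (d := d) R)))
        (PolySite.pt (0 : Site d) (mem_singleton_self 0))) σ :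
        Matrix (Finset (Orb (PolySite (thicken ({0} : Finset (Site d)) R))))
          (Finset (Orb (PolySite (thicken ({0} : Finset (Site d)) R)))) ℂ)‖ ≤ 1 := fun σ => norm_numberOp_le_one _ σ
    refine (norm_add_le _ _).trans ?_
    rw [norm_smul, norm_smul, Complex.norm_real, Complex.norm_real, Real.norm_eq_abs, Real.norm_eq_abs]
    have h1 := (norm_add_le _ _).trans (add_le_add (hn 0) (hn 1))
    have h2 := (norm_mul_le _ _).trans (mul_le_one₀ (hn 0) (norm_nonneg _) (hn 1))
    calc |ε| * _ + |U| * _ ≤ |ε| * (1 + 1) + |U| * 1 :=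
          add_le_add (mul_le_mul_of_nonneg_left h1 (abs_nonneg _)) (mul_le_mul_of_nonneg_left h2 (abs_nonneg _))
      _ = 2 * |ε| + |U| := by ring
  · rw [if_neg hc, map_zero, norm_zero]
    positivity

/-- **`|e_{Φ}(ω)| ≤ 2|ε| + |U|` for every state.** [cite: BratteliRobinsonI1987, Prop. 2.3.11] -/
theorem InfVolFermionState.abs_meanEnergy_sublatticeOnSite_le (ω : InfVolFermionState d) (q : Fin d → ℕ) (c : Site d)
    (ε U R : ℝ) : |ω.meanEnergy (sublatticeOnSite q c ε U) R| ≤ 2 * |ε| + |U| :=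
  (ω.abs_meanEnergy_le_norm _ R).trans (norm_meanEnergyObs_sublatticeOnSite_le q c ε U R)

/-- **The views of a sublattice on-site pattern** from the points of the fundamental cell (coset label re-centred).
[cite: ArakiMoriya2003, §4.1] -/
def sublatticeOnSiteViews (q : Fin d → ℕ) (c : Site d) (ε U : ℝ) : Cell q → FermionInteraction d :=
  fun n => sublatticeOnSite q (c - cellPos n) ε U

/-- Every on-site view's cell-averaged energy is bounded by `2|ε| + |U|`. [cite: BratteliRobinsonI1987, Prop. 2.3.11] -/
theorem abs_cellEnergy_sublatticeOnSiteViews_le (q : Fin d → ℕ) (c : Site d) (ε U R : ℝ) (ω : InfVolFermionState d) :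
    |ω.cellEnergy (sublatticeOnSiteViews q c ε U) R| ≤ 2 * |ε| + |U| := by
  have hcard : (0 : ℝ) < (Fintype.card (Cell q) : ℝ) := Nat.cast_pos.2 Fintype.card_pos
  rw [InfVolFermionState.cellEnergy, abs_mul, abs_of_pos (inv_pos.2 hcard)]
  calc (Fintype.card (Cell q) : ℝ)⁻¹ * |∑ n : Cell q, (ω.shift (cellPos n)).meanEnergy (sublatticeOnSiteViews q c ε U n) R|
      ≤ (Fintype.card (Cell q) : ℝ)⁻¹ * ∑ _n : Cell q, (2 * |ε| + |U|) := by
        refine mul_le_mul_of_nonneg_left ((Finset.abs_sum_le_sum_abs _ _).trans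
          (Finset.sum_le_sum fun n _ => ?_)) (inv_pos.2 hcard).le
        exact (ω.shift (cellPos n)).abs_meanEnergy_sublatticeOnSite_le q _ ε U R
    _ = 2 * |ε| + |U| := by
        rw [Finset.sum_const, Finset.card_univ, nsmul_eq_mul, ← mul_assoc, inv_mul_cancel₀ hcard.ne', one_mul]

end SubOnSite

/-! ### §6. A worked instance: the STAGGERED-POTENTIAL (ionic) Hubbard model along one axis -/

section Ionic

variable {d : ℕ}

/-- Period `2` along the axis `i₀`, period `1` along the others: the two-sublattice (A/B layers
perpendicular to `e_{i₀}`) superlattice. [cite: ArakiMoriya2003, §4.1] -/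
def layerPeriods (i₀ : Fin d) : Fin d → ℕ := fun i => if i = i₀ then 1 else 0

/-- **The ionic (staggered-potential) Hubbard model as a superlattice family**: translation-invariant part
`Φ^{t,U}` (constant views) plus the two sublattice site energies `θ = (ε_A, ε_B)` on the layers `x_{i₀}` even /
odd — `viewFamily` with the on-site views of the cosets of `0` and `e_{i₀}` as directions. The cell energy is
jointly concave in `(ε_A, ε_B)` over every state class and `2`-Lipschitz in each (file
`SuperlatticeCellEnergyFamilies` + `abs_cellEnergy_sublatticeOnSiteViews_le`). [cite: KomaTasaki1994, §1] -/
def ionicHubbardViews (i₀ : Fin d) (t U : ℝ) (θ : Fin 2 → ℝ) : Cell (layerPeriods i₀) → FermionInteraction d :=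
  viewFamily (fun _ => hubbardFermionInteraction d t U)
    (![sublatticeOnSiteViews (layerPeriods i₀) 0 1 0, sublatticeOnSiteViews (layerPeriods i₀) (unitVec i₀) 1 0]) θ

/-- **Joint concavity of the ionic model's variational cell energy in the two site energies** (any class).
[cite: Israel1979, Thm. I.3.4] -/
theorem concaveOn_infCellEnergyOn_ionicHubbard (S : Set (InfVolFermionState d)) (i₀ : Fin d) (t U R : ℝ) :
    ConcaveOn ℝ Set.univ fun θ : Fin 2 → ℝ => infCellEnergyOn S (ionicHubbardViews i₀ t U θ) R :=
  concaveOn_infCellEnergyOn_viewFamily S _ _ R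

/-- **Lipschitz continuity in the site energies** (any non-empty class): the variational cell energy moves by at
most `2(|Δε_A| + |Δε_B|)`. [cite: Israel1979, Thm. I.3.4] -/
theorem abs_infCellEnergyOn_ionicHubbard_sub_le {S : Set (InfVolFermionState d)} (hS : S.Nonempty) (i₀ : Fin d)
    (t U R : ℝ) (θ θ' : Fin 2 → ℝ) :
    |infCellEnergyOn S (ionicHubbardViews i₀ t U θ) R - infCellEnergyOn S (ionicHubbardViews i₀ t U θ') R| ≤
      ∑ a, 2 * |θ a - θ' a| := by
  refine abs_infCellEnergyOn_viewFamily_sub_le _ _ R hS (fun ω _ a => ?_) θ θ'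
  fin_cases a
  · simpa using abs_cellEnergy_sublatticeOnSiteViews_le (layerPeriods i₀) 0 1 0 R ω
  · simpa using abs_cellEnergy_sublatticeOnSiteViews_le (layerPeriods i₀) (unitVec i₀) 1 0 R ω

/-- **At zero staggering the ionic model is the Hubbard model**: over the periodic states its variational cell
energy at `θ = 0` is the translation-invariant Hubbard density `e₀(Φ^{t,U})`. [cite: BratteliKishimotoRobinson1978, Thm. 2 (condition 2)] -/
theorem infCellEnergyOn_ionicHubbard_zero (i₀ : Fin d) (t U R : ℝ) :
    infCellEnergyOn (periodicStates (layerPeriods i₀)) (ionicHubbardViews i₀ t U 0) R =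
      (hubbardFermionInteraction d t U).tiGroundEnergyDensity R := by
  have h : ionicHubbardViews i₀ t U 0 = fun _ => hubbardFermionInteraction d t U := by
    funext n
    simp only [ionicHubbardViews, viewFamily, FermionInteraction.linearFamily_zero]
  rw [h]
  exact infCellEnergyOn_periodic_const_eq_tiGroundEnergyDensity _ _ R

end Ionic

end Literature.MathematicalPhysics.QuantumLattice

end
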